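import Summits.QuantumFields.BalabanUV.Beta.GAN24.DerivativeRateTransferJensenMassFreeLogarithm

/-!
# `BalabanUV.Beta.GAN24.DerivativeRateTransferJensenMassFreeLogarithmCommute` — binder row G-an2-4 ∕ (CONV-C), route R6 «VALUES, NOT DERIVATIVES», PART 73:
# THE SMALL LOGARITHM STAYS IN THE COMMUTANT — if an orthogonal `J` commutes with `G` then it commutes with the small logarithm of `G` (uniqueness in the
# ball), hence with the exp-mean-log link `exp(Σ_x q_x log(τ_xτ₀ᵀ))·τ₀` of `J`-commuting transports: for a complex structure `J` (realified `U(N) =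
# O(2N) ∩ {J-linear}`) U(N)-valued transports give a U(N)-valued (1.28) link — the scope remark of PART 65 for the polar links, now for the second
# convention (unit b2b-balaban-gan24-p3, gen 45; v1)

NOT IN PRINT; OUR PROOF (for the ROUTE; [folklore] — PART 69's injectivity of `exp` on the ball `‖·‖ ≤ ¼`, Mathlib `Matrix.exp_units_conj`, `Commute.exp_right`,
PART 66's orthogonal invariance of the Frobenius norm).  HONEST FRAMING (cell contract, verbatim): «discharging `BetaPertH` makes Bałaban's UV stability
UNCONDITIONAL — a real constructive-QFT result; it is NOT the continuum limit and NOT the Clay problem.»  HONEST DEPENDENCY (verbatim): «continuum YM on T⁴ ⇐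
BetaPertH ∧ nine spine estimates (0/9 proved); BetaPertH ⇐ (D1) ∧ (D4) ∧ CAP+tail; G-an2-4 gates asym, D1 and NE2/3/4.»

WHAT THIS FILE PROVES (0 sorry, 0 `def`, nothing cited): `frob_norm_conj_orthogonal` (`‖J·A·Jᵀ‖ = ‖A‖`), `exp_conj_orthogonal` (`exp(J·A·Jᵀ) = J·exp(A)·Jᵀ`),
**`commute_log_of_commute`** (`JᵀJ = 1`, `JG = GJ`, `‖A‖ ≤ ¼`, `exp A = G` ⟹ `JA = AJ`), `commute_expMean` (`J` commutes with every `A_x` and with `τ₀` ⟹ with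
`exp(Σ_x q_x•A_x)·τ₀`), **`exists_skew_logs_of_transports_commute`** (PART 69's logarithms of `J`-commuting transports commute with `J`, and so does the
(1.28) link).  Scope: `SU(N)`'s determinant phase and other structure groups NOT addressed.  SUPPLIER work on route R6 (rank 2, REDUCTION, no seat); no
consumer of record; NEVER «G-an2-4 closed»; NOT (CONV-C), NOT D1, NOT `BetaPertH`, NOT continuum, NOT Clay.  Records: `HOME/b2b-balaban-gan24-p3/WOODBURY-FIBRE.md` v14.5. -/

noncomputable section

open scoped Matrix Matrix.Norms.Frobenius
open NormedSpace Finset Matrix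

namespace Summit.QuantumFields.BalabanUV.Beta.GAN24.DerivativeRateTransferJensenMassFreeLogarithmCommute

open Summit.QuantumFields.BalabanUV.Beta.GAN24.DerivativeRateTransferJensenMassFreePolarNear
open Summit.QuantumFields.BalabanUV.Beta.GAN24.DerivativeRateTransferJensenMassFreeLogarithm

variable {o ν : Type*} [Fintype o] [DecidableEq o]

/-- conjugation by an orthogonal matrix preserves the Frobenius norm: `‖J·A·Jᵀ‖ = ‖A‖`. [folklore] -/
theorem frob_norm_conj_orthogonal {J : Matrix o o ℝ} (hJ : Jᵀ * J = 1) (A : Matrix o o ℝ) : ‖J * A * Jᵀ‖ = ‖A‖ := by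
  rw [frob_norm_mul_orthogonal _ (by rw [transpose_transpose]; exact hJ), frob_norm_orthogonal_mul _ hJ]

/-- `exp(J·A·Jᵀ) = J·exp(A)·Jᵀ` for orthogonal `J` (Mathlib `Matrix.exp_units_conj` with the unit `⟨J, Jᵀ⟩`). [folklore] -/
theorem exp_conj_orthogonal {J : Matrix o o ℝ} (hJ : Jᵀ * J = 1) (A : Matrix o o ℝ) : exp (J * A * Jᵀ) = J * exp A * Jᵀ := by
  have hJ' : J * Jᵀ = 1 := mul_eq_one_comm.mp hJ
  have h := Matrix.exp_units_conj (⟨J, Jᵀ, hJ', hJ⟩ : (Matrix o o ℝ)ˣ) A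
  simpa only [Units.val_mk, Units.inv_mk] using h

/-- **`commute_log_of_commute` — THE SMALL LOGARITHM STAYS IN THE COMMUTANT** [folklore; our proof]: if `J` is orthogonal and commutes with `G`, and `A`
is the small logarithm of `G` (`‖A‖ ≤ ¼`, `exp A = G`), then `J` commutes with `A` (`JAJᵀ` is another small logarithm of `JGJᵀ = G`). -/
theorem commute_log_of_commute {J G A : Matrix o o ℝ} (hJ : Jᵀ * J = 1) (hGJ : Commute J G) (hA : ‖A‖ ≤ 1 / 4) (hAG : exp A = G) :
    Commute J A := by
  have hJ' : J * Jᵀ = 1 := mul_eq_one_comm.mp hJ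
  have h1 : exp (J * A * Jᵀ) = exp A := by
    rw [exp_conj_orthogonal hJ, hAG, hGJ.eq, Matrix.mul_assoc, hJ', Matrix.mul_one]
  have h2 : J * A * Jᵀ = A := by
    refine exp_injOn_ball ?_ ?_ h1
    · rw [Metric.mem_closedBall, dist_zero_right, frob_norm_conj_orthogonal hJ]; exact hA
    · rw [Metric.mem_closedBall, dist_zero_right]; exact hA
  have h3 : J * A = A * J := by
    calc J * A = J * A * (Jᵀ * J) := by rw [hJ, Matrix.mul_one]
      _ = (J * A * Jᵀ) * J := by simp only [Matrix.mul_assoc]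
      _ = A * J := by rw [h2]
  exact h3

/-- the exp-mean-log link commutes with `J` when the logarithms and the base do. [folklore] -/
theorem commute_expMean [Fintype ν] {J τ₀ : Matrix o o ℝ} {q : ν → ℝ} {A : ν → Matrix o o ℝ} (hA : ∀ x, Commute J (A x))
    (hτ₀ : Commute J τ₀) : Commute J (exp (∑ x, q x • A x) * τ₀) :=
  Commute.mul_right (Commute.exp_right (Commute.sum_right _ _ _ fun x _ => (hA x).smul_right (q x))) hτ₀

/-- **`exists_skew_logs_of_transports_commute` — U(N)-VALUED TRANSPORTS GIVE A U(N)-VALUED (1.28) LINK** [our proof]: PART 69's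
`exists_skew_logs_of_transports` with an orthogonal `J` commuting with every `τ_x` and with `τ₀`: the skew logarithms commute with `J`, and so does
`exp(Σ_x q_x•A_x)·τ₀` for every weight `q` (for a complex structure `J`, `J`-commuting orthogonal = unitary). -/
theorem exists_skew_logs_of_transports_commute [Fintype ν] {τ : ν → Matrix o o ℝ} {τ₀ J : Matrix o o ℝ} (hτ : ∀ x, (τ x)ᵀ * τ x = 1)
    (hτ₀ : τ₀ᵀ * τ₀ = 1) (hJ : Jᵀ * J = 1) (hJτ : ∀ x, Commute J (τ x)) (hJτ₀ : Commute J τ₀)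
    {D : ℝ} (hD : ∀ x, ‖τ x * τ₀ᵀ - 1‖ ≤ D) (hD8 : D ≤ 1 / 8) :
    ∃ A : ν → Matrix o o ℝ, (∀ x, (A x)ᵀ = -A x) ∧ (∀ x, ‖A x‖ ≤ 2 * D) ∧ (∀ x, exp (A x) * τ₀ = τ x) ∧ (∀ x, Commute J (A x)) ∧
      ∀ q : ν → ℝ, Commute J (exp (∑ x, q x • A x) * τ₀) := by
  obtain ⟨A, hAt, hA2, hA4, hAe⟩ := exists_skew_logs_of_transports hτ hτ₀ hD hD8
  have hτ₀' : τ₀ * τ₀ᵀ = 1 := mul_eq_one_comm.mp hτ₀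
  -- `J` commutes with `τ₀ᵀ` (transpose of `Jτ₀ = τ₀J` with `Jᵀ = J⁻¹`) hence with the loops `τ_xτ₀ᵀ`
  have hJt : Commute J τ₀ᵀ := by
    have h : τ₀ᵀ * J = J * τ₀ᵀ := by
      calc τ₀ᵀ * J = τ₀ᵀ * J * (τ₀ * τ₀ᵀ) := by rw [hτ₀', Matrix.mul_one]
        _ = τ₀ᵀ * (J * τ₀) * τ₀ᵀ := by simp only [Matrix.mul_assoc]
        _ = τ₀ᵀ * (τ₀ * J) * τ₀ᵀ := by rw [hJτ₀.eq]
        _ = (τ₀ᵀ * τ₀) * J * τ₀ᵀ := by simp only [Matrix.mul_assoc]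
        _ = J * τ₀ᵀ := by rw [hτ₀, Matrix.one_mul]
    exact h.symm
  have hJG : ∀ x, Commute J (τ x * τ₀ᵀ) := fun x => (hJτ x).mul_right hJt
  have hcomm : ∀ x, Commute J (A x) := fun x =>
    commute_log_of_commute hJ (hJG x) (hA4 x) (by rw [← hAe x, Matrix.mul_assoc, hτ₀', Matrix.mul_one])
  exact ⟨A, hAt, hA2, hAe, hcomm, fun q => commute_expMean hcomm hJτ₀⟩

end Summit.QuantumFields.BalabanUV.Beta.GAN24.DerivativeRateTransferJensenMassFreeLogarithmCommute
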